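import Summits.BirchSwinnertonDyer.BirchSwinnertonDyer.Theorems.PrintCf2RamifiedOffTYZGenusPeriodExactDescent
import HarnessLib

/-!
# WORKFILE (crux stmt-BirchSwinnertonDyer-20509 `RamifiedOffTYZOfFacts`, line `offtyz-v7`, LEAD cruxlead-20509 g29, cycle 30) —
# THEOREM A (the first Kummer coordinate of the genus period in closed form) AS A TYPED STATEMENT, and the reading
# «first norm trivial ⟹ C⁺ on the visible R2 rows is the square class of ONE elliptic-unit norm»

Status: `def … : Prop` only because this is a crux WORKFILE (`Cruxes/RamifiedOffTYZOfFacts/Lines/`), never a Theorems/Literature proposal.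
Nothing here is asserted.  Companion memo `Lines/offtyz_v7_ExactDescent.md` (§2: THEOREM A with its paper proof; §1: the exact descent lemma;
§3: non-congruence of `√(x − 2i)`); kernel files of the cycle: `Theorems/PrintCf2RamifiedOffTYZGenusPeriodExactDescent.lean` (p799839),
`…CurveATwoDivisionAlgebra.lean` (p800643), `…GenusPeriodTraceNorm.lean`, `…GenusPeriodDescent.lean` (the exact descent lemma PROVED: the
identities `κ⁰_{ℍ′}(Z(d)) = [N₁]`, `κ⁺_{ℍ′}(Z(d)) = [N₀]` from the seven-block display); evidence `EXACT-DESCENT-g29.md` on item 20509;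
instrument `xnorm.py`.  BSD is not proved by any of this; 20509 / 23431 / 23432 OPEN.

THEOREM A (memo §2; square-free `n ≡ 7 (mod 8)`, `K = ℚ(√−n)`, `H` Hilbert class field, `L` genus field, `z_n ∈ A(H)` the level-32 Heegner point,
`N₁ := N_{H/L}(x(z_n))`):  `H(√x(z_n))` is the ray class field of `K` of conductor `𝔭̄³` (`√x = η(16τ)³/(η(8τ)η(32τ)²)` lives on the Shimura cover
`ker(2/·) ⊂ Γ₀(32)`; Shimura reciprocity), hence `L(√N₁)` is cut out by `χ_R ∘ Ver` and
**`[N₁]_L ≠ 1 ⟺ 4-rank Cl(−n) = 0, or 4-rank Cl(−n) = 1 and the Rédei divisor d₄ ≡ ±3 (mod 8)`** (25/25 numerically, incl. non-block-free rows).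
On R2 (`n = lq`, `l ≡ 1`, `q ≡ 7 (mod 8)`, `(l/q) = 1`: 4-rank `≥ 1`, every divisor `≡ ±1`) this says `N₁ ∈ L^{×2} ⊂ ℍ′^{×2}` — typed below as
`FirstNormSquareR2` in the display currency of the kernel files (the hypothesis `hA : sqClass N₁ = 1` of
`GenusPeriodExactDescent.levelTwo_iff_secondNorm_of_visible_R2` / `GenusPeriodTraceNorm.levelTwo_iff_secondNorm_of_visible_R2_of_facts`).
The general criterion needs class-group vocabulary (`4`-rank, ambiguous classes); it is recorded in prose only.
-/

noncomputable section

open scoped Classical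

open WeierstrassCurve WeierstrassCurve.Affine WeierstrassCurve.Affine.Point
  Literature.NumberTheory.EllipticCurves Literature.NumberTheory.EllipticCurves.Rank1Residual
  Summit.BirchSwinnertonDyer.Rank1Residual
  Literature.NumberTheory.EllipticCurves.TianYuanZhang2017
  Literature.NumberTheory.EllipticCurves.TianYuanZhang2017.W2
  Literature.NumberTheory.EllipticCurves.TianYuanZhang2017.GenusPointData
  Summit.BirchSwinnertonDyer.PrintCf2.VisibleGenerator

set_option autoImplicit false

namespace Summit.BirchSwinnertonDyer.PrintCf2.LevelTwo.ExactDescent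

variable {n : ℕ}

/-! ## §1 THEOREM A on R2 as a typed statement (display currency) -/

/-- **THEOREM A at a block `d` of a package `D` (display currency): the first norm is a square.**  For every realisation of the seven-block display at
`d` (`M ⊇ ℍ′_n`, `ι`, `z = (x₀, y₀)`, `Φ` with `ι(Z(d)) = Σ_{t∈Φ} z^t`, no `z^t` a cusp, (S3)), every `N₁ ∈ ℍ′_n` with `ι(N₁) = ∏_{t∈Φ} t x₀`
(`= N_{H_d/L_d}(x(z_d))`) is a square in `ℍ′_n`.  Memo §2 proves this on paper when the `4`-rank of `Cl(−d)` is `≥ 2`, or `= 1` with Rédei divisor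
`≡ ±1 (mod 8)` — in particular for every R2 row.  (Caveat of the display currency: stated for every package, it is formally stronger than the
statement about TYZ's actual objects; the same convention as g27/g28's typed laws.) -/
def FirstNormSquareAt (D : GenusPointData n) (d : ℕ) : Prop :=
  ∀ (M : Type) (_ : Field M) (_ : NumberField M) (_ : IsGalois ℚ M) (ι : D.H →ₐ[ℚ] M) (x₀ y₀ : M)
    (h₀ : (curveA.baseChange M).toAffine.Nonsingular x₀ y₀) (Φ : Finset (M ≃ₐ[ℚ] M)),
    (Point.map (W' := curveA) ι (D.Z d) = ∑ t ∈ Φ, galPtOver M t (.some x₀ y₀ h₀) ∧ Φ.card = gK d) →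
    (∀ t ∈ Φ, ¬ ((2 : ℕ) • galPtOver M t (.some x₀ y₀ h₀) = 0 ∨ (2 : ℕ) • galPtOver M t (.some x₀ y₀ h₀) = tauOne)) →
    (∀ g : M ≃ₐ[ℚ] M, D.TrivialOnLOver ι d g →
      ∃ π : Φ → Φ, Function.Bijective π ∧ ∀ t : Φ, galPtOver M g (galPtOver M (t : M ≃ₐ[ℚ] M) (.some x₀ y₀ h₀)) = galPtOver M (π t : M ≃ₐ[ℚ] M) (.some x₀ y₀ h₀)) →
    ∀ N₁ : D.H, ι N₁ = ∏ t ∈ Φ, (t : M ≃ₐ[ℚ] M) x₀ → ∃ r : D.H, N₁ = r ^ 2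

/-- **THEOREM A on R2 (typed conjecture-grade item candidate; a theorem on paper, memo §2).**  For primes `l ≡ 1`, `q ≡ 7 (mod 8)` with `(l/q) = 1`
and every display package `D` of `lq`: `FirstNormSquareAt D (lq)`. -/
def FirstNormSquareR2 : Prop :=
  ∀ (l q : ℕ), l.Prime → q.Prime → l % 8 = 1 → q % 8 = 7 → IsSquare ((l : ℤ) : ZMod q) →
    ∀ D : GenusPointData (l * q), D.Printed → D.CMPointCompositumPrinted → D.Thm35AtBlocks → FirstNormSquareAt D (l * q)

/-! ## §2 Reading: THEOREM A turns the exact-descent hypothesis `hED0` into `[N₁] = 1` -/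

/-- **`FirstNormSquareAt` ⟹ the class `[N₁]` is trivial** for any `N₁` with the norm description (the hypothesis `hA` of the kernel criteria).
[cite: SilvermanAEC2009, Prop. X.1.4] -/
theorem sqClass_firstNorm_eq_one (D : GenusPointData n) {d : ℕ} (hA : FirstNormSquareAt D d)
    {M : Type} [Field M] [NumberField M] [IsGalois ℚ M] (ι : D.H →ₐ[ℚ] M) {x₀ y₀ : M}
    (h₀ : (curveA.baseChange M).toAffine.Nonsingular x₀ y₀) (Φ : Finset (M ≃ₐ[ℚ] M))
    (hS1 : Point.map (W' := curveA) ι (D.Z d) = ∑ t ∈ Φ, galPtOver M t (.some x₀ y₀ h₀) ∧ Φ.card = gK d)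
    (hS2 : ∀ t ∈ Φ, ¬ ((2 : ℕ) • galPtOver M t (.some x₀ y₀ h₀) = 0 ∨ (2 : ℕ) • galPtOver M t (.some x₀ y₀ h₀) = tauOne))
    (hS3 : ∀ g : M ≃ₐ[ℚ] M, D.TrivialOnLOver ι d g →
      ∃ π : Φ → Φ, Function.Bijective π ∧ ∀ t : Φ, galPtOver M g (galPtOver M (t : M ≃ₐ[ℚ] M) (.some x₀ y₀ h₀)) = galPtOver M (π t : M ≃ₐ[ℚ] M) (.some x₀ y₀ h₀))
    {N₁ : D.H} (hN₁ : ι N₁ = ∏ t ∈ Φ, (t : M ≃ₐ[ℚ] M) x₀) (hN0 : N₁ ≠ 0) :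
    sqClass N₁ = 1 := by
  obtain ⟨r, hr⟩ := hA M inferInstance inferInstance inferInstance ι x₀ y₀ h₀ Φ hS1 hS2 hS3 N₁ hN₁
  exact (sqClass_eq_one_iff hN0).mpr ⟨r, hr⟩

end Summit.BirchSwinnertonDyer.PrintCf2.LevelTwo.ExactDescent

end
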